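import Literature.Analysis.Complex.VitaliConvergence
import Mathlib.Topology.Connected.LocallyConnected
import HarnessLib

/-!
# Identity transport under Vitali convergence: two normal families that agree on an accumulating
# set have the same limit everywhere

Analysis/Complex support file (everything proved; no definitions, no named facts), a companion of
`Literature/Analysis/Complex/VitaliConvergence.lean`.  The device is the one by which properties
proved for a real sub-interval of a parameter are transported to the whole domain of analyticity
once Vitali's theorem has produced the limit (Glimm–Jaffe, *Quantum Physics*, Thm 4.6.2 and Cor. 18.1.4:
"from analyticity of the finite volume Schwinger functions, from Vitali's theorem, and from the
convergence … for `λ` real"): if two locally bounded sequences of holomorphic functions on a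
connected open `U` converge on a set `s` accumulating at a point of `U`, and their limits AGREE on `s`,
then both converge locally uniformly on `U` to ONE holomorphic function — in particular their limits
agree at every point of `U` (identity theorem applied to the difference of the two Vitali limits).
Typical use: `F n` the `n`-th approximant of a correlation function at a test datum `f`, `G n` the
same at a transformed datum (a rotate, a translate, a Ward-identity combination), `s` the sub-segment
of the parameter domain where the limit theory is known to be symmetric — the symmetry then holds at
every parameter reached by the analytic continuation.

* `frequently_nhdsNE_of_seq` — bookkeeping: a sequence in `s \ {z₀}` tending to `z₀` makes `s`
  accumulate at `z₀` in the sense `∃ᶠ z in 𝓝[≠] z₀, z ∈ s` used by the Vitali file;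
* `frequently_nhdsNE_ofReal_mem_image_Icc` — the real segment `[a, b] ⊆ ℂ` accumulates at each of
  its points `x₀ ∈ [a, b)`;
* `exists_tendstoLocallyUniformlyOn_of_tendsto_on` — Vitali's theorem with the pointwise-convergence
  hypothesis on an accumulating set `s`;
* `exists_common_limit_of_agree_on` — **identity transport**: agreement of the limits on `s` forces
  one common locally uniform holomorphic limit on `U`;
* `limit_eq_of_agree_on` — pointwise corollary: limits at any `w ∈ U` coincide;
* `exists_open_preconnected_between` — a connected set inside two open sets lies in one connected
  OPEN set inside both (the connected component of the intersection), the domain on which two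
  continuations with different natural domains are compared.

References: Titchmarsh, *The Theory of Functions*, §5.21 (Vitali); Conway, *Functions of One Complex
Variable* VII §2; Glimm–Jaffe 1987, §4.6 and §18.1.  Everything here is standard and tagged folklore.
-/

noncomputable section

open Filter Set Metric Topology Complex

namespace Literature.Analysis.Complex

variable {U : Set ℂ}

/-! ### Accumulating sets -/

/-- A set containing a sequence of points different from `z₀` and tending to `z₀` accumulates at
`z₀`: `∃ᶠ z in 𝓝[≠] z₀, z ∈ s`. [folklore] -/
theorem frequently_nhdsNE_of_seq {s : Set ℂ} {z₀ : ℂ} {u : ℕ → ℂ} (hu : Tendsto u atTop (𝓝 z₀))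
    (hne : ∀ j, u j ≠ z₀) (hmem : ∀ j, u j ∈ s) : ∃ᶠ z in 𝓝[≠] z₀, z ∈ s := by
  have hw : Tendsto u atTop (𝓝[≠] z₀) :=
    tendsto_nhdsWithin_iff.mpr ⟨hu, Eventually.of_forall fun j => hne j⟩
  exact hw.frequently (Eventually.of_forall hmem).frequently

/-- **The real segment accumulates at each of its non-terminal points**: for `x₀ ∈ [a, b)` the
image of `[a, b]` in `ℂ` meets every punctured neighbourhood of `x₀` (along `x₀ + (b − x₀)/(j+2)`).
[folklore] -/
theorem frequently_nhdsNE_ofReal_mem_image_Icc {a b x₀ : ℝ} (hx₀ : x₀ ∈ Ico a b) :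
    ∃ᶠ z in 𝓝[≠] ((x₀ : ℝ) : ℂ), z ∈ (fun t : ℝ => (t : ℂ)) '' Icc a b := by
  have hpos : 0 < b - x₀ := sub_pos.2 hx₀.2
  set u : ℕ → ℝ := fun j => x₀ + (b - x₀) / ((j : ℝ) + 2) with hu
  have hden : ∀ j : ℕ, (0 : ℝ) < (j : ℝ) + 2 := fun j => by positivity
  have hmem : ∀ j, u j ∈ Icc a b := by
    intro j
    have h1 : 0 < (b - x₀) / ((j : ℝ) + 2) := div_pos hpos (hden j)
    have h2 : (b - x₀) / ((j : ℝ) + 2) ≤ (b - x₀) / 2 :=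
      div_le_div_of_nonneg_left hpos.le (by norm_num) (by have : (0 : ℝ) ≤ j := Nat.cast_nonneg j; linarith)
    constructor
    · have := hx₀.1; rw [hu]; linarith
    · rw [hu]; linarith
  have hne : ∀ j, ((u j : ℝ) : ℂ) ≠ ((x₀ : ℝ) : ℂ) := by
    intro j h
    have h1 : 0 < (b - x₀) / ((j : ℝ) + 2) := div_pos hpos (hden j)
    have h2 : u j = x₀ := Complex.ofReal_inj.mp h
    rw [hu] at h2
    linarith
  have htend : Tendsto (fun j => ((u j : ℝ) : ℂ)) atTop (𝓝 ((x₀ : ℝ) : ℂ)) := by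
    have hreal : Tendsto u atTop (𝓝 x₀) := by
      have ht : Tendsto (fun j : ℕ => (j : ℝ) + 2) atTop atTop :=
        tendsto_atTop_add_const_right _ _ tendsto_natCast_atTop_atTop
      have h0 : Tendsto (fun j : ℕ => (b - x₀) / ((j : ℝ) + 2)) atTop (𝓝 0) :=
        ht.const_div_atTop (b - x₀)
      simpa [hu] using tendsto_const_nhds.add h0
    exact (continuous_ofReal.tendsto _).comp hreal
  exact frequently_nhdsNE_of_seq htend hne fun j => ⟨u j, hmem j, rfl⟩

/-! ### Vitali on an accumulating set and the identity transport -/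

/-- **Vitali's theorem, accumulating-set form.**  A locally bounded sequence of holomorphic functions on
a connected open `U` which converges at every point of a set `s` accumulating at some `z₀ ∈ U`
converges locally uniformly on `U` to a holomorphic function. [folklore] -/
theorem exists_tendstoLocallyUniformlyOn_of_tendsto_on (hU : IsOpen U) (hUc : IsPreconnected U)
    {F : ℕ → ℂ → ℂ} (hF : ∀ n, DifferentiableOn ℂ (F n) U)
    (hb : ∀ a ∈ U, ∃ M : ℝ, ∃ r > 0, ∀ n, ∀ z ∈ ball a r ∩ U, ‖F n z‖ ≤ M)
    {z₀ : ℂ} (hz₀ : z₀ ∈ U) {s : Set ℂ} (hs : ∃ᶠ z in 𝓝[≠] z₀, z ∈ s)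
    (hconv : ∀ z ∈ s, ∃ c : ℂ, Tendsto (fun n => F n z) atTop (𝓝 c)) :
    ∃ f : ℂ → ℂ, DifferentiableOn ℂ f U ∧ TendstoLocallyUniformlyOn F f atTop U :=
  exists_tendstoLocallyUniformlyOn_of_frequently_tendsto hU hUc hF hb hz₀ (hs.mono hconv)

/-- **Identity transport.**  Two locally bounded sequences of holomorphic functions on a connected open
`U` whose limits exist AND AGREE at every point of a set `s ⊆ U` accumulating at some `z₀ ∈ U`
converge locally uniformly on `U` to ONE common holomorphic function: each converges by Vitali, the
two limits are holomorphic and agree on `s`, hence frequently near `z₀`, hence on all of `U` by the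
identity theorem (`AnalyticOnNhd.eqOn_of_preconnected_of_frequently_eq`). [folklore] -/
theorem exists_common_limit_of_agree_on (hU : IsOpen U) (hUc : IsPreconnected U)
    {F G : ℕ → ℂ → ℂ} (hF : ∀ n, DifferentiableOn ℂ (F n) U) (hG : ∀ n, DifferentiableOn ℂ (G n) U)
    (hbF : ∀ a ∈ U, ∃ M : ℝ, ∃ r > 0, ∀ n, ∀ z ∈ ball a r ∩ U, ‖F n z‖ ≤ M)
    (hbG : ∀ a ∈ U, ∃ M : ℝ, ∃ r > 0, ∀ n, ∀ z ∈ ball a r ∩ U, ‖G n z‖ ≤ M)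
    {z₀ : ℂ} (hz₀ : z₀ ∈ U) {s : Set ℂ} (hs : ∃ᶠ z in 𝓝[≠] z₀, z ∈ s) (hsU : s ⊆ U)
    (hagree : ∀ z ∈ s, ∃ c : ℂ, Tendsto (fun n => F n z) atTop (𝓝 c) ∧ Tendsto (fun n => G n z) atTop (𝓝 c)) :
    ∃ f : ℂ → ℂ, DifferentiableOn ℂ f U ∧ TendstoLocallyUniformlyOn F f atTop U ∧
      TendstoLocallyUniformlyOn G f atTop U := by
  obtain ⟨f, hf, hFf⟩ := exists_tendstoLocallyUniformlyOn_of_tendsto_on hU hUc hF hbF hz₀ hs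
    fun z hz => (hagree z hz).imp fun _ h => h.1
  obtain ⟨g, hg, hGg⟩ := exists_tendstoLocallyUniformlyOn_of_tendsto_on hU hUc hG hbG hz₀ hs
    fun z hz => (hagree z hz).imp fun _ h => h.2
  -- the two limits agree on `s`
  have hEq : ∀ z ∈ s, f z = g z := by
    intro z hz
    obtain ⟨c, hc, hc'⟩ := hagree z hz
    rw [tendsto_nhds_unique (hFf.tendsto_at (hsU hz)) hc, tendsto_nhds_unique (hGg.tendsto_at (hsU hz)) hc']
  -- hence everywhere on `U`
  have hA : AnalyticOnNhd ℂ f U := (analyticOnNhd_iff_differentiableOn hU).2 hf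
  have hA' : AnalyticOnNhd ℂ g U := (analyticOnNhd_iff_differentiableOn hU).2 hg
  have hEqOn : EqOn f g U :=
    hA.eqOn_of_preconnected_of_frequently_eq hA' hUc hz₀ (hs.mono hEq)
  exact ⟨f, hf, hFf, hGg.congr_right fun z hz => (hEqOn hz).symm⟩

/-- **Identity transport, pointwise form.**  Under the hypotheses of `exists_common_limit_of_agree_on`,
at every `w ∈ U` any limit of `F n w` equals any limit of `G n w`. [folklore] -/
theorem limit_eq_of_agree_on (hU : IsOpen U) (hUc : IsPreconnected U)
    {F G : ℕ → ℂ → ℂ} (hF : ∀ n, DifferentiableOn ℂ (F n) U) (hG : ∀ n, DifferentiableOn ℂ (G n) U)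
    (hbF : ∀ a ∈ U, ∃ M : ℝ, ∃ r > 0, ∀ n, ∀ z ∈ ball a r ∩ U, ‖F n z‖ ≤ M)
    (hbG : ∀ a ∈ U, ∃ M : ℝ, ∃ r > 0, ∀ n, ∀ z ∈ ball a r ∩ U, ‖G n z‖ ≤ M)
    {z₀ : ℂ} (hz₀ : z₀ ∈ U) {s : Set ℂ} (hs : ∃ᶠ z in 𝓝[≠] z₀, z ∈ s) (hsU : s ⊆ U)
    (hagree : ∀ z ∈ s, ∃ c : ℂ, Tendsto (fun n => F n z) atTop (𝓝 c) ∧ Tendsto (fun n => G n z) atTop (𝓝 c))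
    {w : ℂ} (hw : w ∈ U) {c c' : ℂ} (hc : Tendsto (fun n => F n w) atTop (𝓝 c))
    (hc' : Tendsto (fun n => G n w) atTop (𝓝 c')) : c = c' := by
  obtain ⟨f, -, hFf, hGf⟩ := exists_common_limit_of_agree_on hU hUc hF hG hbF hbG hz₀ hs hsU hagree
  rw [tendsto_nhds_unique hc (hFf.tendsto_at hw), tendsto_nhds_unique hc' (hGf.tendsto_at hw)]

/-! ### A common connected domain -/

/-- **A connected set inside two open sets lies in ONE connected open set inside both** — the connected
component, in the intersection, of any of its points (open by local connectedness of `ℂ`).  This is the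
domain on which two analytic continuations with different natural domains are compared. [folklore] -/
theorem exists_open_preconnected_between {U U' S : Set ℂ} (hU : IsOpen U) (hU' : IsOpen U')
    (hS : IsPreconnected S) {x : ℂ} (hx : x ∈ S) (hSU : S ⊆ U) (hSU' : S ⊆ U') :
    ∃ V : Set ℂ, IsOpen V ∧ IsPreconnected V ∧ S ⊆ V ∧ V ⊆ U ∩ U' := by
  refine ⟨connectedComponentIn (U ∩ U') x, (hU.inter hU').connectedComponentIn,
    isPreconnected_connectedComponentIn, ?_, connectedComponentIn_subset _ _⟩
  exact hS.subset_connectedComponentIn hx fun z hz => ⟨hSU hz, hSU' hz⟩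

/-- The real segment `[a, b]`, read in `ℂ`, is preconnected. [folklore] -/
theorem isPreconnected_ofReal_image_Icc (a b : ℝ) :
    IsPreconnected ((fun t : ℝ => (t : ℂ)) '' Icc a b) :=
  isPreconnected_Icc.image _ continuous_ofReal.continuousOn

end Literature.Analysis.Complex

end
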